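import Literature.Analysis.FluidPDE.GalerkinFlow
import Literature.Analysis.FluidPDE.NSGalerkinTrajectory
import Literature.Analysis.FunctionSpaces.TorusSpaceTimeFields

/-!
# Route `WazewskiBlock`, support item `PlanarGalerkinNoTrap` (stmt-AnomalousDissipation-10356):
# the Fourier coefficients of a field-level Galerkin trajectory solve the Galerkin ODE

Helper file for the proof of
`Summit.AnomalousDissipation.AnomalousDissipation.Theses.WazewskiBlock.PlanarGalerkinNoTrap`.
The item quantifies over *field-level* Galerkin trajectories `U : [0, ∞) → (T^d → ℝ^d)` recorded
through the four clauses of `Literature.Analysis.FluidPDE.Torus.IsGalerkinTrajectory ν f N U`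
(joint continuity, Galerkin-mode slices, the Galerkin equations **tested** against every Galerkin
mode of order `N` and integrated in time, the energy identity), whereas the tree's enstrophy
calculus (`Literature.Analysis.FluidPDE.hasDerivWithinAt_enstrophy`) runs on *coefficient-level*
trajectories `Literature.Analysis.FluidPDE.IsGalerkinTrajectory ν S f u₀ α` (the Galerkin ODE
`α' = galerkinRHS S ν f̂ α`). The tree proves coefficient ⇒ field
(`IsGalerkinTrajectory.torus`); this file proves the converse, "finite basis ⇒ `C¹`
coefficients" (Robinson–Rodrigo–Sadowski 2016, Thm. 4.4 Step 1: the tested equations (4.2) ARE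
the ODE (4.5) in the coordinates `c_k = ⟨u, a_k⟩`; Constantin–Foias 1988, Ch. 8, (8.5)):

* `coeff_mem`, `eq_realTrigPoly_coeff`, `continuous_coeff` — the curve
  `α t = (𝓕(U (max t 0))(k))_{|k|² ≤ N²}` is real, divergence free, continuous, and
  `U t = realTrigPoly (freqBall N) ᾱ(t)` for `t ≥ 0`;
* `pairing_sub_pairing_eq_integral` — the tested Galerkin equations in Fourier coordinates:
  `⟪b, α t⟫ - ⟪b, α s⟫ = ∫ₛᵗ ⟪b, V(α τ)⟫` for every phase-space vector `b`
  (master identity I of the tree, `Torus.sum_re_inner_galerkinField_test`, read backwards);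
* `hasDerivWithinAt_coeff` — hence `α' = V(α)` on every `[0, T]` (the primitive
  `α 0 + ∫₀ᵗ V(α)` lives in the closed phase space, agrees with `α` against every phase-space
  vector, hence equals `α`; FTC);
* `isGalerkinTrajectory_coeff` — packaged: `α` is a coefficient-level Galerkin trajectory of
  order `freqBall N` with force `f` from the datum `U 0`.

References: J. C. Robinson, J. L. Rodrigo, W. Sadowski, *The three-dimensional Navier–Stokes
equations*, CUP 2016, §4.1, Thm. 4.4 Step 1, (4.2)–(4.5); P. Constantin, C. Foias,
*Navier–Stokes Equations*, Chicago 1988, Ch. 8, (8.3)–(8.5).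
-/

-- `Summit.<Summit>.<Problem>` is the tree's mandated summit-side namespace (CONVENTIONS §2); for this
-- single-conjunct summit the two coincide, so the duplicate is deliberate.
set_option linter.dupNamespace false

noncomputable section

open MeasureTheory Set Filter Topology UnitAddTorus
open scoped InnerProductSpace RealInnerProductSpace

namespace Summit.AnomalousDissipation.AnomalousDissipation.Theorems.WazewskiBlock.PlanarGalerkinNoTrap

open Literature.Analysis.FunctionSpaces Literature.Analysis.FunctionSpaces.Torus
open Literature.Analysis.FluidPDE

variable {d : Type*} [Fintype d] [DecidableEq d] {ν : ℝ}
  {f : UnitAddTorus d → EuclideanSpace ℝ d} {N : ℕ} {U : ℝ → UnitAddTorus d → EuclideanSpace ℝ d}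

/-! ### The coefficient curve of a field-level Galerkin trajectory -/

/-- The restricted Fourier coefficients of the slices of a field-level Galerkin trajectory lie in
the Galerkin phase space (real and divergence free). [folklore] -/
theorem coeff_mem (hU : Torus.IsGalerkinTrajectory ν f N U) (τ : ℝ) :
    fourierRestrict (freqBall N) (U (max τ 0)) ∈ galerkinSubspace (freqBall N) :=
  (hU.isGalerkinMode (max τ 0) (le_max_right _ _)).fourierRestrict_mem

/-- A slice of a field-level Galerkin trajectory is the real trigonometric polynomial of its own
restricted Fourier coefficients (`P_N (U t) = U t`). [folklore] -/
theorem eq_realTrigPoly_coeff (hU : Torus.IsGalerkinTrajectory ν f N U) {t : ℝ} (ht : 0 ≤ t) :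
    U t = realTrigPoly (freqBall N)
      (coeffExt (freqBall N) (fourierRestrict (freqBall N) (U (max t 0)))) := by
  rw [max_eq_left ht]
  exact (hU.isGalerkinMode t ht).realTrigPoly_fourierRestrict.symm

/-- The coefficient curve `t ↦ (𝓕(U (max t 0))(k))_{|k|² ≤ N²}` of a field-level Galerkin
trajectory is continuous on `ℝ` (joint continuity of `U` on `[0, ∞) × T^d`, tube lemma). [folklore] -/
theorem continuous_coeff (hU : Torus.IsGalerkinTrajectory ν f N U) :
    Continuous fun τ => fourierRestrict (freqBall N) (U (max τ 0)) := by
  have h1 : ContinuousOn (fun s => fourierRestrict (freqBall N) (U s)) (Ici 0) := by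
    refine continuousOn_pi.2 fun k => ?_
    exact continuousOn_mFourierCoeff_of_continuousOn_stLift hU.continuousOn (k : d → ℤ)
  exact h1.comp_continuous (continuous_id.max continuous_const) fun τ =>
    Set.mem_Ici.2 (le_max_right τ 0)

/-- The Galerkin field along the coefficient curve is continuous in time. [folklore] -/
theorem continuous_galerkinRHS_coeff (hU : Torus.IsGalerkinTrajectory ν f N U) :
    Continuous fun τ => galerkinRHS (freqBall N) ν (fourierRestrict (freqBall N) f)
      (fourierRestrict (freqBall N) (U (max τ 0))) := by
  have h := ContinuousOn.galerkinRHS ν (g := fun _ : ℝ => fourierRestrict (freqBall N) f)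
    continuousOn_const ((continuous_coeff hU).continuousOn (s := univ))
  exact continuousOn_univ.1 h

/-! ### The tested Galerkin equations in Fourier coordinates -/

omit [DecidableEq d] in
/-- The real pairing `c ↦ ∑ₖ Re⟪b k, c k⟫_ℂ` with a fixed coefficient vector `b`, as a continuous
`ℝ`-linear functional on `S → ℂ^d`. [folklore] -/
theorem exists_pairingCLM {S : Finset (d → ℤ)} (b : ↥S → EuclideanSpace ℂ d) :
    ∃ L : (↥S → EuclideanSpace ℂ d) →L[ℝ] ℝ, ∀ c, L c = ∑ k, (inner ℂ (b k) (c k)).re := by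
  refine ⟨∑ k : ↥S, (Complex.reCLM.comp ((innerSL ℂ (b k)).restrictScalars ℝ)).comp
    (ContinuousLinearMap.proj (R := ℝ) (φ := fun _ : ↥S => EuclideanSpace ℂ d) k), fun c => ?_⟩
  simp only [sum_apply, ContinuousLinearMap.comp_apply,
    ContinuousLinearMap.proj_apply, ContinuousLinearMap.coe_restrictScalars', innerSL_apply_apply,
    Complex.reCLM_apply]

omit [DecidableEq d] in
/-- Pairings commute with time integrals of continuous coefficient curves:
`∫ₐᵇ ∑ₖ Re⟪b k, V τ k⟫ = ∑ₖ Re⟪b k, (∫ₐᵇ V) k⟫`. [folklore] -/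
theorem intervalIntegral_pairing {S : Finset (d → ℤ)} (b : ↥S → EuclideanSpace ℂ d)
    {V : ℝ → ↥S → EuclideanSpace ℂ d} (hV : Continuous V) (a b' : ℝ) :
    ∫ τ in a..b', ∑ k, (inner ℂ (b k) (V τ k)).re = ∑ k, (inner ℂ (b k) ((∫ τ in a..b', V τ) k)).re := by
  obtain ⟨L, hL⟩ := exists_pairingCLM b
  rw [← hL]
  simp_rw [← hL]
  exact L.intervalIntegral_comp_comm (hV.intervalIntegrable a b')

/-- **The tested Galerkin equations in Fourier coordinates.** Along a field-level Galerkin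
trajectory `U` of order `N` with a steady force `f ∈ L²`, the coefficient curve
`α t = (𝓕(U (max t 0))(k))_{|k|² ≤ N²}` satisfies, for every phase-space vector `b` and
`0 ≤ s ≤ t`, `∑ₖ Re⟪b k, α t k⟫ - ∑ₖ Re⟪b k, α s k⟫ = ∫ₛᵗ ∑ₖ Re⟪b k, V(α τ) k⟫`,
`V = galerkinRHS (freqBall N) ν f̂`: the tested clause against the Galerkin mode
`a = realTrigPoly (freqBall N) b̄`, with both sides moved to the Fourier side by Parseval and
master identity I (`Torus.sum_re_inner_galerkinField_test`), the force by `⟪P_N f, a⟫ = ⟪f, a⟫`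
(Robinson–Rodrigo–Sadowski 2016, (4.2) ⇔ (4.5)). [folklore] -/
theorem pairing_sub_pairing_eq_integral (hU : Torus.IsGalerkinTrajectory ν f N U)
    (hf : MemLp f 2 volume) {b : ↥(freqBall (d := d) N) → EuclideanSpace ℂ d}
    (hb : b ∈ galerkinSubspace (freqBall N)) {s t : ℝ} (hs : 0 ≤ s) (hst : s ≤ t) :
    (∑ k, (inner ℂ (b k) (fourierRestrict (freqBall N) (U (max t 0)) k)).re) -
        ∑ k, (inner ℂ (b k) (fourierRestrict (freqBall N) (U (max s 0)) k)).re =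
      ∫ τ in s..t, ∑ k, (inner ℂ (b k) (galerkinRHS (freqBall N) ν
        (fourierRestrict (freqBall N) f) (fourierRestrict (freqBall N) (U (max τ 0))) k)).re := by
  have hS : ∀ k ∈ freqBall (d := d) N, -k ∈ freqBall (d := d) N := neg_mem_freqBall_of_mem
  have ha : IsGalerkinMode N (realTrigPoly (freqBall N) (coeffExt (freqBall N) b)) :=
    isGalerkinMode_realTrigPoly_coeffExt hb
  have hcb : IsConjSymm (coeffExt (freqBall N) b) := hb.1.isConjSymm_coeffExt hS
  have hband : ∀ k ∉ freqBall N, mFourierCoeff (EuclideanSpace.complexify ∘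
      realTrigPoly (freqBall N) (coeffExt (freqBall N) b)) k = 0 := fun k hk =>
    mFourierCoeff_realTrigPoly_eq_zero hS hcb hk
  have hcoef : ∀ k ∈ freqBall N, mFourierCoeff (EuclideanSpace.complexify ∘
      realTrigPoly (freqBall N) (coeffExt (freqBall N) b)) k = coeffExt (freqBall N) b k :=
    fun k hk => by rw [mFourierCoeff_realTrigPoly hS hcb, if_pos hk]
  -- the pairings `⟪U τ, a⟫` on the Fourier side
  have hpair : ∀ τ, 0 ≤ τ →
      ∫ x, ⟪U τ x, realTrigPoly (freqBall N) (coeffExt (freqBall N) b) x⟫ =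
        ∑ k, (inner ℂ (b k) (fourierRestrict (freqBall N) (U (max τ 0)) k)).re := by
    intro τ hτ
    rw [max_eq_left hτ, integral_inner_realTrigPoly_right hS hcb (hU.memLp hτ 2),
      sum_coeffExt (fun k v => (inner ℂ (mFourierCoeff (EuclideanSpace.complexify ∘ U τ) k) v).re)]
    refine Finset.sum_congr rfl fun k _ => ?_
    rw [fourierRestrict_apply]
    exact inner_re_symm (𝕜 := ℂ) _ _
  -- the right-hand side on the Fourier side (master identity I)
  have hgr : IsRealCoeff (fourierRestrict (freqBall N) f) :=
    isRealCoeff_mFourierCoeff (hf.integrable one_le_two)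
  have hD : ∀ τ, 0 ≤ τ →
      ∫ x, (⟪U τ x, convect (U τ) (realTrigPoly (freqBall N) (coeffExt (freqBall N) b)) x⟫ +
        ν * ⟪U τ x, Torus.laplacian (realTrigPoly (freqBall N) (coeffExt (freqBall N) b)) x⟫ +
        ⟪f x, realTrigPoly (freqBall N) (coeffExt (freqBall N) b) x⟫) =
      ∑ k, (inner ℂ (b k) (galerkinRHS (freqBall N) ν (fourierRestrict (freqBall N) f)
        (fourierRestrict (freqBall N) (U (max τ 0))) k)).re := by
    intro τ hτ
    have hmem := coeff_mem hU τ
    have hI := Torus.sum_re_inner_galerkinField_test ν hS (hgr.isConjSymm_coeffExt hS)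
      (hmem.1.isConjSymm_coeffExt hS) hmem.2.isTransversal_coeffExt ha.isSmooth ha.isDivFree hband
    rw [← eq_realTrigPoly_coeff hU hτ] at hI
    have hforce : ∫ x, ⟪realTrigPoly (freqBall N) (coeffExt (freqBall N)
        (fourierRestrict (freqBall N) f)) x, realTrigPoly (freqBall N) (coeffExt (freqBall N) b) x⟫ =
        ∫ x, ⟪f x, realTrigPoly (freqBall N) (coeffExt (freqBall N) b) x⟫ := by
      rw [realTrigPoly_coeffExt_fourierRestrict]
      exact integral_inner_fourierTruncate_eq hf (ha.isSmooth.memLp 2) hband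
    have hu : IsSmooth (U τ) := hU.isSmooth hτ
    have iAB : Integrable (fun x =>
        ⟪U τ x, convect (U τ) (realTrigPoly (freqBall N) (coeffExt (freqBall N) b)) x⟫ +
        ν * ⟪U τ x, Torus.laplacian (realTrigPoly (freqBall N) (coeffExt (freqBall N) b)) x⟫) volume :=
      (hu.inner (hu.convect ha.isSmooth)).integrable.add
        (((hu.inner ha.isSmooth.laplacian).integrable).const_mul ν)
    have iP : Integrable (fun x => ⟪realTrigPoly (freqBall N) (coeffExt (freqBall N)
        (fourierRestrict (freqBall N) f)) x, realTrigPoly (freqBall N) (coeffExt (freqBall N) b) x⟫)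
        volume :=
      ((isSmooth_realTrigPoly _ _).inner ha.isSmooth).integrable
    have iF : Integrable (fun x => ⟪f x, realTrigPoly (freqBall N) (coeffExt (freqBall N) b) x⟫)
        volume :=
      integrable_inner_of_continuous (hf.integrable one_le_two) ha.isSmooth.continuous
    rw [integral_add iAB iF, ← hforce, ← integral_add iAB iP, ← hI,
      Finset.sum_congr rfl fun k hk => by rw [hcoef k hk],
      sum_coeffExt (fun k v => (inner ℂ (Torus.galerkinField ν (freqBall N)
        (coeffExt (freqBall N) (fourierRestrict (freqBall N) f))
        (coeffExt (freqBall N) (fourierRestrict (freqBall N) (U (max τ 0)))) k) v).re)]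
    refine Finset.sum_congr rfl fun k _ => ?_
    rw [galerkinRHS_apply]
    exact inner_re_symm (𝕜 := ℂ) _ _
  -- the tested clause against `a`
  have hgal := hU.galerkin _ ha s t hs hst
  rw [hpair t (hs.trans hst), hpair s hs] at hgal
  rw [hgal]
  refine intervalIntegral.integral_congr fun τ hτ => ?_
  rw [uIcc_of_le hst] at hτ
  exact hD τ (hs.trans hτ.1)

/-! ### The Galerkin ODE for the coefficient curve -/

omit [DecidableEq d] in
/-- A coefficient vector in the phase space that pairs to zero with itself vanishes:
`∑ₖ Re⟪w k, w k⟫ = ∑ₖ ‖w k‖² = 0 ⇒ w = 0`. [folklore] -/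
theorem eq_zero_of_pairing_self_eq_zero {S : Finset (d → ℤ)} {w : ↥S → EuclideanSpace ℂ d}
    (hw : ∑ k, (inner ℂ (w k) (w k)).re = 0) : w = 0 := by
  have hsq : ∑ k, ‖w k‖ ^ 2 = 0 := by
    rw [← hw]
    exact Finset.sum_congr rfl fun k _ => (inner_self_eq_norm_sq (𝕜 := ℂ) (w k)).symm
  have hk := (Finset.sum_eq_zero_iff_of_nonneg fun k _ => sq_nonneg ‖w k‖).1 hsq
  funext k
  have := hk k (Finset.mem_univ k)
  rw [sq_eq_zero_iff, norm_eq_zero] at this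
  exact this

/-- **The coefficient curve solves the Galerkin ODE.** Along a field-level Galerkin trajectory
`U` of order `N` with a steady force `f ∈ L²`, the curve
`α t = (𝓕(U (max t 0))(k))_{|k|² ≤ N²}` satisfies
`α' = galerkinRHS (freqBall N) ν f̂ α` on every `[0, T]` (one-sided at the endpoints). Proof: the
primitive `Ψ t = α 0 + ∫₀ᵗ V(α τ) dτ` is differentiable with derivative `V(α t)` (FTC, `V ∘ α`
continuous), takes values in the closed phase space `galerkinSubspace (freqBall N)`, and by
`pairing_sub_pairing_eq_integral` pairs with every phase-space vector exactly as `α t` does; so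
`Ψ t - α t` is a phase-space vector pairing to zero with itself, `Ψ = α` on `[0, ∞)`
(Robinson–Rodrigo–Sadowski 2016, Thm. 4.4 Step 1: (4.2) is the ODE (4.5)). [folklore] -/
theorem hasDerivWithinAt_coeff (hU : Torus.IsGalerkinTrajectory ν f N U) (hf : MemLp f 2 volume)
    (T : ℝ) {t : ℝ} (ht : t ∈ Icc 0 T) :
    HasDerivWithinAt (fun τ => fourierRestrict (freqBall N) (U (max τ 0)))
      (galerkinRHS (freqBall N) ν (fourierRestrict (freqBall N) f)
        (fourierRestrict (freqBall N) (U (max t 0)))) (Icc 0 T) t := by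
  have hS : ∀ k ∈ freqBall (d := d) N, -k ∈ freqBall (d := d) N := neg_mem_freqBall_of_mem
  set W : Submodule ℝ (↥(freqBall (d := d) N) → EuclideanSpace ℂ d) := galerkinSubspace (freqBall N)
    with hW
  set g : ↥(freqBall (d := d) N) → EuclideanSpace ℂ d := fourierRestrict (freqBall N) f with hg
  set α : ℝ → ↥(freqBall (d := d) N) → EuclideanSpace ℂ d :=
    fun τ => fourierRestrict (freqBall N) (U (max τ 0)) with hα
  have hgr : IsRealCoeff g := isRealCoeff_mFourierCoeff (hf.integrable one_le_two)
  have hmem : ∀ τ, α τ ∈ W := coeff_mem hU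
  have hV_cont : Continuous fun τ => galerkinRHS (freqBall N) ν g (α τ) :=
    continuous_galerkinRHS_coeff hU
  -- the phase-space-valued field along `α` and its primitive
  set F : ℝ → W := fun τ => ⟨galerkinRHS (freqBall N) ν g (α τ), galerkinRHS_mem ν hS hgr (hmem τ)⟩
    with hF
  have hF_cont : Continuous F := hV_cont.subtype_mk _
  have hF_int : ∀ a b' : ℝ, IntervalIntegrable F volume a b' := fun a b' =>
    hF_cont.intervalIntegrable a b'
  have hΨ_deriv : ∀ s, HasDerivAt (fun u => (⟨α 0, hmem 0⟩ : W) + ∫ τ in (0 : ℝ)..u, F τ) (F s) s :=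
    fun s => (intervalIntegral.integral_hasDerivAt_right (hF_int 0 s)
      (hF_cont.stronglyMeasurableAtFilter _ _) hF_cont.continuousAt).const_add _
  have hcoe_int : ∀ u, ((∫ τ in (0 : ℝ)..u, F τ : W) : ↥(freqBall (d := d) N) → EuclideanSpace ℂ d) =
      ∫ τ in (0 : ℝ)..u, galerkinRHS (freqBall N) ν g (α τ) := fun u => by
    rw [← Submodule.subtypeL_apply, ← W.subtypeL.intervalIntegral_comp_comm (hF_int 0 u)]
    rfl
  -- the primitive, seen in `S → ℂ^d`, has derivative `V(α s)`
  have hβ_deriv : ∀ s, HasDerivAt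
      (fun u => (((⟨α 0, hmem 0⟩ : W) + ∫ τ in (0 : ℝ)..u, F τ : W) :
        ↥(freqBall (d := d) N) → EuclideanSpace ℂ d))
      (galerkinRHS (freqBall N) ν g (α s)) s :=
    fun s => W.subtypeL.hasFDerivAt.comp_hasDerivAt s (hΨ_deriv s)
  -- and agrees with `α` on `[0, ∞)`
  have hβα : ∀ s, 0 ≤ s → (((⟨α 0, hmem 0⟩ : W) + ∫ τ in (0 : ℝ)..s, F τ : W) :
      ↥(freqBall (d := d) N) → EuclideanSpace ℂ d) = α s := by
    intro s hs
    have hcoe : (((⟨α 0, hmem 0⟩ : W) + ∫ τ in (0 : ℝ)..s, F τ : W) :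
        ↥(freqBall (d := d) N) → EuclideanSpace ℂ d) =
        α 0 + ∫ τ in (0 : ℝ)..s, galerkinRHS (freqBall N) ν g (α τ) := by
      rw [Submodule.coe_add, hcoe_int]
    set w : ↥(freqBall (d := d) N) → EuclideanSpace ℂ d :=
      (α 0 + ∫ τ in (0 : ℝ)..s, galerkinRHS (freqBall N) ν g (α τ)) - α s with hw
    have hw_mem : w ∈ W := by
      refine W.sub_mem ?_ (hmem s)
      rw [← hcoe]
      exact Submodule.coe_mem _
    have hw_pair : ∑ k, (inner ℂ (w k) (w k)).re = 0 := by
      have hid : (∑ k, (inner ℂ (w k) (α s k)).re) - ∑ k, (inner ℂ (w k) (α 0 k)).re =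
          ∫ τ in (0 : ℝ)..s, ∑ k, (inner ℂ (w k) (galerkinRHS (freqBall N) ν g (α τ) k)).re :=
        pairing_sub_pairing_eq_integral hU hf hw_mem le_rfl hs
      rw [intervalIntegral_pairing w hV_cont] at hid
      have hsplit : ∀ k, (inner ℂ (w k) (w k)).re =
          ((inner ℂ (w k) (α 0 k)).re + (inner ℂ (w k)
            ((∫ τ in (0 : ℝ)..s, galerkinRHS (freqBall N) ν g (α τ)) k)).re) -
            (inner ℂ (w k) (α s k)).re := by
        intro k
        calc (inner ℂ (w k) (w k)).re = (inner ℂ (w k) (α 0 k +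
              (∫ τ in (0 : ℝ)..s, galerkinRHS (freqBall N) ν g (α τ)) k - α s k)).re := rfl
          _ = _ := by rw [inner_sub_right, inner_add_right, Complex.sub_re, Complex.add_re]
      rw [Finset.sum_congr rfl fun k _ => hsplit k, Finset.sum_sub_distrib, Finset.sum_add_distrib]
      linarith
    have hw0 : w = 0 := eq_zero_of_pairing_self_eq_zero hw_pair
    rw [hcoe]
    exact (sub_eq_zero.1 hw0)
  -- conclude
  refine ((hβ_deriv t).hasDerivWithinAt.congr_of_mem (fun τ hτ => ?_) ht)
  exact (hβα τ hτ.1).symm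

/-- **Field-level Galerkin trajectories are coefficient-level Galerkin trajectories.** For a
field-level Galerkin trajectory `U` of order `N` with a steady force `f ∈ L²`
(`Torus.IsGalerkinTrajectory ν f N U`), the coefficient curve
`α t = (𝓕(U (max t 0))(k))_{|k|² ≤ N²}` is a Galerkin trajectory of the tree's coefficient-level
kind — `IsGalerkinTrajectory ν (freqBall N) f (U 0) α`: datum `P_N (U 0)`, values in the phase
space, continuous, solving the Galerkin ODE on every `[0, T]` — and `U t = realTrigPoly ᾱ(t)` for
`t ≥ 0` (`eq_realTrigPoly_coeff`). Converse of the tree's `IsGalerkinTrajectory.torus`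
(Robinson–Rodrigo–Sadowski 2016, Thm. 4.4 Step 1). [folklore] -/
theorem isGalerkinTrajectory_coeff (hU : Torus.IsGalerkinTrajectory ν f N U) (hf : MemLp f 2 volume) :
    IsGalerkinTrajectory ν (freqBall N) f (U 0)
      (fun τ => fourierRestrict (freqBall N) (U (max τ 0))) where
  symm := neg_mem_freqBall_of_mem
  initial := by
    show fourierRestrict (freqBall N) (U (max 0 0)) = _
    rw [max_self]
  mem := coeff_mem hU
  continuousOn := (continuous_coeff hU).continuousOn
  hasDerivWithinAt T _ ht := hasDerivWithinAt_coeff hU hf T ht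

end Summit.AnomalousDissipation.AnomalousDissipation.Theorems.WazewskiBlock.PlanarGalerkinNoTrap

end
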